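import Summits.QuantumFields.GaugeBoot.SchwingerDysonStates
import Summits.QuantumFields.GaugeBoot.SchwingerDysonPair
import Literature.LinearAlgebra.Matrix.UnitaryGroupExpSurjective
import Literature.MathematicalPhysics.QuantumLattice.RepLieAlgebraUnitary
import Literature.MathematicalPhysics.QuantumLattice.TorusWilsonGibbs
import HarnessLib

/-!
# The Schwinger–Dyson (derivative-form loop) equations determine the Wilson measure in finite volume, at every coupling (gauge-boot, L1 supplement)

HONEST FRAMING (cell `pub-gaugeboot`, page 1 of every file): the venture produces certified bounds
on lattice expectations at stated coupling, gauge group, dimension and torus size; NOT a mass gap,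
NOT a continuum limit, NOT a string tension; NOT Yang–Mills-summit-bearing (barriers
`FixedCouplingUltralocality`, `PerturbativeInvisibility`). This module is a structural statement
about finite periodic lattices; it certifies no number.

## Content

`PeriodicHaarShiftUniqueness.lean` showed that the MEASURE form of the loop equations (the one-link
Haar-shift identities) has exactly one probability solution in finite volume, the Wilson measure.
The lattice bootstrap, however, writes its rows in DERIVATIVE form — the one-link Schwinger–Dyson
identities `∫ f' dμ = β ∫ f S' dμ` along `U ↦ U[e ↦ e^{tX} U_e]` (tree
`integral_shiftDeriv_eq_wilson`, cell `sd_pair` / `loopEquation_of_sdPair`). With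
`SchwingerDysonStates.lean` (derivative form ⇔ measure form, by the averaging trick of
`FlowSchwingerDyson.lean`) this file closes the circle:

* ★★★ `TiltedRP.eq_gibbs_iff_sd` — on every finite periodic lattice `(A, e)` of
  `TiltedLatticeGauge.lean` (cubic tori, 45°-tilted boxes), for `G` compact metrisable with a family
  of continuous one-parameter subgroups exhausting `G` along which the Wilson action is
  differentiable, `ρ` continuous and EVERY real `β`: a probability measure is a Schwinger–Dyson
  state of the Wilson action iff it IS `gibbs ρ e β`;
* ★★★ `eq_wilsonMeasure_iff_sd` — the same for Wave 0's torus measure `wilsonMeasure ρ β` on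
  `(ℤ/L)^d`;
* ★★★ `eq_wilsonMeasure_iff_sd_suN` / `eq_wilsonMeasure_iff_sd_uN` — UNCONDITIONAL for `SU(N)` and
  `U(N)` in the fundamental representation with the exponential one-parameter subgroups
  `t ↦ e^{tX}`, `X ∈ 𝔰𝔲(N)` (resp. `𝔲(N)`): every group element is such an exponential (tree,
  Bröcker–tom Dieck IV (2.2): `exists_mem_skewAdjoint_trace_zero_exp_eq`,
  `exists_mem_skewAdjoint_exp_eq`) and the Wilson action is differentiable along them (tree
  `exists_hasDerivAt_wilsonAction_oneLink`). So on the finite torus, at every `β`: a probability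
  measure satisfies ALL one-link Schwinger–Dyson identities (all links, all directions `X`, all
  observables differentiable along the shift) iff it is Wilson's measure — the derivative-form loop
  equations together with realisability by a probability measure determine every expectation.

What is NOT here: a statement about the finitely many WORD rows a bootstrap SDP actually uses
(single-trace Wilson-loop functionals); the uniqueness needs the full test class.

References: M. Creutz, *Quarks, gluons and lattices* (1983) Ch. 11; Th. Bröcker, T. tom Dieck,
*Representations of Compact Lie Groups* (1985) IV (2.2); V. Kazakov, Z. Zheng, arXiv:2203.11360
§2; P. Anderson, M. Kruczenski, Nucl. Phys. B 921 (2017) §2. Folklore.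
-/

noncomputable section

open MeasureTheory
open scoped Matrix.Norms.Frobenius
open Literature.MathematicalPhysics.QuantumFieldTheory (haarProbability)

namespace Summit.QuantumFields.GaugeBoot

/-! ## Finite periodic lattices -/

namespace TiltedRP

variable {A : Type*} [AddCommGroup A] [Fintype A] [DecidableEq A] {d N : ℕ} {G : Type*} [Group G]
  [TopologicalSpace G] [IsTopologicalGroup G] [CompactSpace G] [MeasurableSpace G] [BorelSpace G]
  [T2Space G] [SecondCountableTopology G] [Nonempty G] (ρ : G →* Matrix (Fin N) (Fin N) ℂ)
  {K : Type*} {k : K → ℝ → G}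

/-- ★★ **On a finite periodic lattice a Schwinger–Dyson probability state of the Wilson action IS
the Wilson measure**, at every real `β` (family of continuous one-parameter subgroups exhausting
`G`, `ρ` continuous). [folklore] -/
theorem eq_gibbs_of_sd (hkc : ∀ a, Continuous (k a)) (hk : ∀ a s t, k a (s + t) = k a s * k a t)
    (hG : ∀ g : G, ∃ a t, k a t = g) (hρ : Continuous ρ) (e : Fin d → A) {β : ℝ}
    {μ : Measure (Config A d G)} [IsProbabilityMeasure μ]
    (hμ : IsSchwingerDysonState k (fun _ => wilsonAction ρ e) β μ) : μ = gibbs ρ e β := by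
  rw [eq_pi_tilted_of_sd hkc hk hG (continuous_wilsonAction ρ hρ e) hμ]
  rfl

/-- ★★★ **The derivative-form loop equations have exactly one probability solution on a finite
periodic lattice**: with a family of continuous one-parameter subgroups exhausting `G` along which
the Wilson action is differentiable with continuous derivative (`hSd`), `ρ` continuous and any real
`β`, a probability measure on `Config A d G` is a Schwinger–Dyson state of the Wilson action iff it
is `gibbs ρ e β`. [folklore] -/
theorem eq_gibbs_iff_sd (hkc : ∀ a, Continuous (k a)) (hk : ∀ a s t, k a (s + t) = k a s * k a t)
    (hG : ∀ g : G, ∃ a t, k a t = g) (hρ : Continuous ρ) (e : Fin d → A)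
    (hSd : ∀ (l : Link A d) (a : K), ∃ S' : Config A d G → ℝ, Continuous S' ∧
      ∀ U, HasDerivAt (fun t => wilsonAction ρ e (Function.update U l (k a t * U l))) (S' U) 0)
    (β : ℝ) (μ : Measure (Config A d G)) [IsProbabilityMeasure μ] :
    μ = gibbs ρ e β ↔ IsSchwingerDysonState k (fun _ => wilsonAction ρ e) β μ :=
  eq_pi_tilted_iff_sd hkc hk hG (continuous_wilsonAction ρ hρ e) hSd β μ

end TiltedRP

/-! ## The cubic torus of Wave 0 -/

section Torus

open Literature.MathematicalPhysics.QuantumFieldTheory (Edge GaugeConfig wilsonAction wilsonMeasure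
  continuous_wilsonAction_of_continuous)
open Literature.MathematicalPhysics.QuantumLattice (wilsonMeasure_eq_tilted_pi)

variable {d L N : ℕ} {G : Type*} [Group G] [TopologicalSpace G] [IsTopologicalGroup G]
  [CompactSpace G] [MeasurableSpace G] [BorelSpace G] [T2Space G] [SecondCountableTopology G]
  [Nonempty G] (ρ : G →* Matrix (Fin N) (Fin N) ℂ) {K : Type*} {k : K → ℝ → G}

/-- ★★ **On the torus `(ℤ/L)^d` a Schwinger–Dyson probability state of the Wilson action IS Wilson's
measure**, at every real `β` (family of continuous one-parameter subgroups exhausting `G`, `ρ`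
continuous). [folklore] -/
theorem eq_wilsonMeasure_of_sd [NeZero L] (hkc : ∀ a, Continuous (k a))
    (hk : ∀ a s t, k a (s + t) = k a s * k a t) (hG : ∀ g : G, ∃ a t, k a t = g)
    (hρ : Continuous ρ) {β : ℝ} {μ : Measure (GaugeConfig d L G)} [IsProbabilityMeasure μ]
    (hμ : IsSchwingerDysonState k (fun _ => wilsonAction ρ) β μ) : μ = wilsonMeasure ρ β := by
  rw [eq_pi_tilted_of_sd hkc hk hG (continuous_wilsonAction_of_continuous ρ hρ) hμ,
    wilsonMeasure_eq_tilted_pi ρ hρ β]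

/-- ★★★ **On the torus the derivative-form loop equations have exactly one probability solution**:
with a family of continuous one-parameter subgroups exhausting `G` along which the Wilson action is
differentiable with continuous derivative, `ρ` continuous and any real `β`, a probability measure on
`GaugeConfig d L G` satisfies all one-link Schwinger–Dyson identities iff it is `wilsonMeasure ρ β`.
[folklore] -/
theorem eq_wilsonMeasure_iff_sd [NeZero L] (hkc : ∀ a, Continuous (k a))
    (hk : ∀ a s t, k a (s + t) = k a s * k a t) (hG : ∀ g : G, ∃ a t, k a t = g)
    (hρ : Continuous ρ)
    (hSd : ∀ (e : Edge d L) (a : K), ∃ S' : GaugeConfig d L G → ℝ, Continuous S' ∧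
      ∀ U, HasDerivAt (fun t => wilsonAction ρ (Function.update U e (k a t * U e))) (S' U) 0)
    (β : ℝ) (μ : Measure (GaugeConfig d L G)) [IsProbabilityMeasure μ] :
    μ = wilsonMeasure ρ β ↔ IsSchwingerDysonState k (fun _ => wilsonAction ρ) β μ := by
  rw [wilsonMeasure_eq_tilted_pi ρ hρ β]
  exact eq_pi_tilted_iff_sd hkc hk hG (continuous_wilsonAction_of_continuous ρ hρ) hSd β μ

end Torus

/-! ## `SU(N)` and `U(N)`: the exponential one-parameter subgroups -/

section Unitary

open Literature.MathematicalPhysics.QuantumFieldTheory (Edge GaugeConfig wilsonAction wilsonMeasure)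
open Literature.MathematicalPhysics.QuantumLattice
open Literature.LinearAlgebra.Matrix (exists_mem_skewAdjoint_trace_zero_exp_eq
  exists_mem_skewAdjoint_exp_eq)
open Summit.QuantumFields.YangMills.Cruxes.CurvatureAmnesia.WardDefect.SchwingerDyson
  (exists_hasDerivAt_wilsonAction_oneLink)

variable {d L : ℕ}

/-- The Lie algebra `𝔰𝔲(N)` as an index type: traceless skew-Hermitian matrices. [folklore] -/
abbrev SuGenerator (N : ℕ) : Type :=
  {X : Matrix (Fin N) (Fin N) ℂ // X ∈ skewAdjoint (Matrix (Fin N) (Fin N) ℂ) ∧ X.trace = 0}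

/-- The Lie algebra `𝔲(N)` as an index type: skew-Hermitian matrices. [folklore] -/
abbrev UGenerator (N : ℕ) : Type :=
  {X : Matrix (Fin N) (Fin N) ℂ // X ∈ skewAdjoint (Matrix (Fin N) (Fin N) ℂ)}

/-- The exponential one-parameter subgroup `t ↦ e^{tX}` of `SU(N)` generated by `X ∈ 𝔰𝔲(N)`
(tree `mem_oneParamGenerators_specialUnitaryGroup`). [folklore] -/
def suExp (N : ℕ) (X : SuGenerator N) (t : ℝ) : Matrix.specialUnitaryGroup (Fin N) ℂ :=
  ⟨NormedSpace.exp (t • (X : Matrix (Fin N) (Fin N) ℂ)),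
    mem_oneParamGenerators_specialUnitaryGroup (skewAdjoint.mem_iff.1 X.2.1) X.2.2 t⟩

/-- The exponential one-parameter subgroup `t ↦ e^{tX}` of `U(N)` generated by `X ∈ 𝔲(N)`
(tree `mem_oneParamGenerators_unitaryGroup`). [folklore] -/
def uExp (N : ℕ) (X : UGenerator N) (t : ℝ) : Matrix.unitaryGroup (Fin N) ℂ :=
  ⟨NormedSpace.exp (t • (X : Matrix (Fin N) (Fin N) ℂ)),
    mem_oneParamGenerators_unitaryGroup (skewAdjoint.mem_iff.1 X.2) t⟩

/-- `e^{tX}` as a matrix. -/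
@[simp] theorem coe_suExp (N : ℕ) (X : SuGenerator N) (t : ℝ) :
    ((suExp N X t : Matrix.specialUnitaryGroup (Fin N) ℂ) : Matrix (Fin N) (Fin N) ℂ) =
      NormedSpace.exp (t • (X : Matrix (Fin N) (Fin N) ℂ)) := rfl

/-- `e^{tX}` as a matrix. -/
@[simp] theorem coe_uExp (N : ℕ) (X : UGenerator N) (t : ℝ) :
    ((uExp N X t : Matrix.unitaryGroup (Fin N) ℂ) : Matrix (Fin N) (Fin N) ℂ) =
      NormedSpace.exp (t • (X : Matrix (Fin N) (Fin N) ℂ)) := rfl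

/-- `t ↦ e^{tX}` is continuous. [folklore] -/
theorem continuous_suExp (N : ℕ) (X : SuGenerator N) : Continuous (suExp N X) := by
  have h : Continuous fun t : ℝ => NormedSpace.exp (t • (X : Matrix (Fin N) (Fin N) ℂ)) :=
    NormedSpace.exp_continuous.comp (by fun_prop)
  exact h.subtype_mk _

/-- `t ↦ e^{tX}` is continuous. [folklore] -/
theorem continuous_uExp (N : ℕ) (X : UGenerator N) : Continuous (uExp N X) := by
  have h : Continuous fun t : ℝ => NormedSpace.exp (t • (X : Matrix (Fin N) (Fin N) ℂ)) :=
    NormedSpace.exp_continuous.comp (by fun_prop)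
  exact h.subtype_mk _

/-- `e^{(s+t)X} = e^{sX} e^{tX}` in `SU(N)`. [folklore] -/
theorem suExp_add (N : ℕ) (X : SuGenerator N) (s t : ℝ) :
    suExp N X (s + t) = suExp N X s * suExp N X t := by
  refine Subtype.ext ?_
  change NormedSpace.exp ((s + t) • (X : Matrix (Fin N) (Fin N) ℂ)) =
    NormedSpace.exp (s • (X : Matrix (Fin N) (Fin N) ℂ)) * NormedSpace.exp (t • (X : Matrix _ _ ℂ))
  rw [add_smul]
  exact Matrix.exp_add_of_commute _ _ (((Commute.refl (X : Matrix (Fin N) (Fin N) ℂ)).smul_left s).smul_right t)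

/-- `e^{(s+t)X} = e^{sX} e^{tX}` in `U(N)`. [folklore] -/
theorem uExp_add (N : ℕ) (X : UGenerator N) (s t : ℝ) :
    uExp N X (s + t) = uExp N X s * uExp N X t := by
  refine Subtype.ext ?_
  change NormedSpace.exp ((s + t) • (X : Matrix (Fin N) (Fin N) ℂ)) =
    NormedSpace.exp (s • (X : Matrix (Fin N) (Fin N) ℂ)) * NormedSpace.exp (t • (X : Matrix _ _ ℂ))
  rw [add_smul]
  exact Matrix.exp_add_of_commute _ _ (((Commute.refl (X : Matrix (Fin N) (Fin N) ℂ)).smul_left s).smul_right t)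

/-- **Every element of `SU(N)` lies on an exponential one-parameter subgroup** (Bröcker–tom Dieck
IV (2.2), tree `exists_mem_skewAdjoint_trace_zero_exp_eq`). [folklore] -/
theorem exists_suExp_eq (N : ℕ) (g : Matrix.specialUnitaryGroup (Fin N) ℂ) :
    ∃ (X : SuGenerator N) (t : ℝ), suExp N X t = g := by
  obtain ⟨X, hX, htr, hexp⟩ := exists_mem_skewAdjoint_trace_zero_exp_eq g
  refine ⟨⟨X, hX, htr⟩, 1, Subtype.ext ?_⟩
  change NormedSpace.exp ((1 : ℝ) • X) = (g : Matrix (Fin N) (Fin N) ℂ)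
  rw [one_smul, hexp]

/-- **Every element of `U(N)` lies on an exponential one-parameter subgroup** (Bröcker–tom Dieck
IV (2.2), tree `exists_mem_skewAdjoint_exp_eq`). [folklore] -/
theorem exists_uExp_eq (N : ℕ) (g : Matrix.unitaryGroup (Fin N) ℂ) :
    ∃ (X : UGenerator N) (t : ℝ), uExp N X t = g := by
  obtain ⟨X, hX, hexp⟩ := exists_mem_skewAdjoint_exp_eq g
  refine ⟨⟨X, hX⟩, 1, Subtype.ext ?_⟩
  change NormedSpace.exp ((1 : ℝ) • X) = (g : Matrix (Fin N) (Fin N) ℂ)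
  rw [one_smul, hexp]

/-- The torus Wilson action of `SU(N)` is differentiable along every exponential one-link shift,
with a continuous derivative (tree `exists_hasDerivAt_wilsonAction_oneLink`). [folklore] -/
theorem exists_hasDerivAt_wilsonAction_suExp [NeZero L] (N : ℕ) (e : Edge d L) (X : SuGenerator N) :
    ∃ S' : GaugeConfig d L (Matrix.specialUnitaryGroup (Fin N) ℂ) → ℝ, Continuous S' ∧
      ∀ U, HasDerivAt (fun t => wilsonAction (fundamentalRep (Fin N))
        (Function.update U e (suExp N X t * U e))) (S' U) 0 :=
  exists_hasDerivAt_wilsonAction_oneLink (fundamentalRep (Fin N)) (continuous_fundamentalRep _)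
    (suExp_add N X) (X := (X : Matrix (Fin N) (Fin N) ℂ)) (fun t => by
      rw [fundamentalRep_apply, coe_suExp, Complex.coe_smul]) e

/-- The torus Wilson action of `U(N)` is differentiable along every exponential one-link shift,
with a continuous derivative. [folklore] -/
theorem exists_hasDerivAt_wilsonAction_uExp [NeZero L] (N : ℕ) (e : Edge d L) (X : UGenerator N) :
    ∃ S' : GaugeConfig d L (Matrix.unitaryGroup (Fin N) ℂ) → ℝ, Continuous S' ∧
      ∀ U, HasDerivAt (fun t => wilsonAction (unitaryFundamentalRep (Fin N) ℂ)
        (Function.update U e (uExp N X t * U e))) (S' U) 0 :=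
  exists_hasDerivAt_wilsonAction_oneLink (unitaryFundamentalRep (Fin N) ℂ)
    (continuous_unitaryFundamentalRep _ _) (uExp_add N X) (X := (X : Matrix (Fin N) (Fin N) ℂ))
    (fun t => by rw [unitaryFundamentalRep_apply, coe_uExp, Complex.coe_smul]) e

/-- ★★★ **`SU(N)` lattice Yang–Mills on the torus `(ℤ/L)^d`, fundamental representation, ANY real
`β`, any `d`, `L ≥ 1`, `N`: a probability measure on the gauge configurations satisfies the one-link
Schwinger–Dyson identities `∫ f' dμ = β ∫ f S' dμ` for every link `e`, every direction `X ∈ 𝔰𝔲(N)`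
and every continuous observable `f` differentiable along `U ↦ U[e ↦ e^{tX} U_e]` with continuous
derivative — the derivative form of the loop equations, whose word instances are the cell's
`sd_pair` / `loopEquation_specialUnitaryGroup` rows — IF AND ONLY IF it is Wilson's measure.**
Unconditional: exp-surjectivity of `SU(N)` and differentiability of the Wilson action are theorems
of the tree. [folklore] -/
theorem eq_wilsonMeasure_iff_sd_suN [NeZero L] (N : ℕ) (β : ℝ)
    (μ : Measure (GaugeConfig d L (Matrix.specialUnitaryGroup (Fin N) ℂ))) [IsProbabilityMeasure μ] :
    μ = wilsonMeasure (fundamentalRep (Fin N)) β ↔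
      IsSchwingerDysonState (suExp N) (fun _ => wilsonAction (fundamentalRep (Fin N))) β μ :=
  eq_wilsonMeasure_iff_sd (fundamentalRep (Fin N)) (continuous_suExp N) (suExp_add N)
    (fun g => exists_suExp_eq N g) (continuous_fundamentalRep _)
    (fun e X => exists_hasDerivAt_wilsonAction_suExp N e X) β μ

/-- ★★★ **`U(N)` lattice gauge theory on the torus, fundamental representation, ANY real `β`: a
probability measure satisfies all one-link Schwinger–Dyson identities along the exponential shifts
`U ↦ U[e ↦ e^{tX} U_e]`, `X ∈ 𝔲(N)`, iff it is Wilson's measure.** [folklore] -/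
theorem eq_wilsonMeasure_iff_sd_uN [NeZero L] (N : ℕ) (β : ℝ)
    (μ : Measure (GaugeConfig d L (Matrix.unitaryGroup (Fin N) ℂ))) [IsProbabilityMeasure μ] :
    μ = wilsonMeasure (unitaryFundamentalRep (Fin N) ℂ) β ↔
      IsSchwingerDysonState (uExp N) (fun _ => wilsonAction (unitaryFundamentalRep (Fin N) ℂ)) β μ :=
  eq_wilsonMeasure_iff_sd (unitaryFundamentalRep (Fin N) ℂ) (continuous_uExp N) (uExp_add N)
    (fun g => exists_uExp_eq N g) (continuous_unitaryFundamentalRep _ _)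
    (fun e X => exists_hasDerivAt_wilsonAction_uExp N e X) β μ

/-- ★★ **In particular a Schwinger–Dyson probability state of `SU(N)` lattice Yang–Mills on the
torus has the Wilson-measure expectation of EVERY observable** — the derivative-form loop equations
plus realisability determine all Wilson loops in finite volume. [folklore] -/
theorem IsSchwingerDysonState.integral_eq_suN [NeZero L] {N : ℕ} {β : ℝ}
    {μ : Measure (GaugeConfig d L (Matrix.specialUnitaryGroup (Fin N) ℂ))} [IsProbabilityMeasure μ]
    (hμ : IsSchwingerDysonState (suExp N) (fun _ => wilsonAction (fundamentalRep (Fin N))) β μ)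
    (F : GaugeConfig d L (Matrix.specialUnitaryGroup (Fin N) ℂ) → ℝ) :
    ∫ U, F U ∂μ = ∫ U, F U ∂(wilsonMeasure (fundamentalRep (Fin N)) β) := by
  rw [(eq_wilsonMeasure_iff_sd_suN N β μ).2 hμ]

end Unitary

end Summit.QuantumFields.GaugeBoot

end
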